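import Summits.RiemannHypothesis.RiemannHypothesis.Theorems.Splittings.LiLowZeroBudgetPrelim
import HarnessLib

/-!
# RH-free LOW-ZERO BUDGET [γ] — phases, amplitudes, per-pair bounds, the NEAR part (SketchG6B §§5–7)

Cell rh-split, seat rh-split-li-bridge g6 (brief sha16 f79c5f09d8bcb036), card `run/shared/lean/pub/rh-split/cards/SPLIT-li-bridge.md` §13
(13.5 paper proof «SOUND ON PAPER», referee rh-split-ref g3 06:17:36Z; 13.17); kernel source `HOME/rh-split-li-bridge/SketchG6T.lean` sha16
911a043700f05677 (2287 l; = SketchG6B [γ] ++ SketchG6C [α][β] ++ Part D [δ] ++ Part T, re-pointed at the tree's `LiIncrMeanSquare` /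
`LiIncrBlockLaw`, p508264 / p508611).  Filed by rh-split-typer-2 g4 (lane (xi)(c)–(f)) as a chain of ten tree modules cut at the scratch's
section boundaries, decl text byte-verbatim; deltas = namespaces `RhSplit.LiBridgeG6B/C/D/T` ↦
`…Theorems.Splittings.{LiLowZeroBudget, LiIncrHighPart, LiIncrBlockLawOfRH}` (qualified cross-references rewritten), module docstrings, and
one-line docstrings added where the scratch had none.  END-TO-END statement of the chain (last file):
`LiIncrBlockLawOfRH.rh_iff_almostAllLiMonotone : RiemannHypothesis ↔ ∃ E ⊆ ℕ of natural density zero, ∀ n ≥ 1, n ∉ E → λ_n ≤ λ_{n+1}`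
— T-Li3 IN KERNEL, a RELABELLING of RH (RH-EQUIVALENT, PROVED; certifies nothing about RH; class (li, bridge) unchanged).

This file: §5 phases `θ_γ = liZeroAngle γ` and amplitudes `4 sin(θ_γ/2)`, §6 the budget and the per-pair bounds, §7 the NEAR part
`Σ_ρ Σ_{|γ−γ'|<1} term ≤ 26.4 · P · N`.

HONEST LABEL: «SPLITTING SEARCH over kernel-typed RH-EQUIVALENCES; a splitting A ∧ B ⟹ RH is CONDITIONAL bookkeeping unless A and B are
both proved; nothing here bears on the truth of RH.»
-/

set_option linter.dupNamespace false

noncomputable section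

namespace Summit.RiemannHypothesis.RiemannHypothesis.Theorems.Splittings.LiLowZeroBudget

open Finset
open Literature.NumberTheory.LFunctions Literature.NumberTheory.LFunctions.SchoenfeldBound
open Summit.RiemannHypothesis.RiemannHypothesis.Theorems.LiTheory
open Summit.RiemannHypothesis.RiemannHypothesis.Theorems.Splittings.LiIncrMeanSquare.MeanSquare

/-! ## §5 Phases and amplitudes -/

/-- `θ_ρ := liZeroAngle (Im ρ)`. -/
def phase (ρ : ℂ) : ℝ := liZeroAngle ρ.im

/-- `a_ρ := 4 sin(θ_ρ/2)` (the multiplicity is kept as a separate factor). -/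
def amp (ρ : ℂ) : ℝ := 4 * Real.sin (liZeroAngle ρ.im / 2)

/-- Auxiliary lemma `amp_bounds` of the low-zero budget [γ] (pairs / NEAR part) (li-bridge g6 `SketchG6T`; see the module docstring for its place in the argument). -/
theorem amp_bounds {ρ : ℂ} (hγ : 14 < ρ.im) : 0 ≤ amp ρ ∧ amp ρ ≤ 2 / ρ.im := by
  have hγ0 : 0 < ρ.im := by linarith
  obtain ⟨h0, h1⟩ := SmoothReplace.liZeroAngle_bounds hγ0
  have hinv : 1 / ρ.im ≤ 1 := by rw [div_le_one hγ0]; linarith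
  have hθπ : liZeroAngle ρ.im / 2 ≤ Real.pi := by linarith [Real.pi_gt_three]
  have hsin0 : 0 ≤ Real.sin (liZeroAngle ρ.im / 2) :=
    Real.sin_nonneg_of_nonneg_of_le_pi (by linarith) hθπ
  have hsin1 : Real.sin (liZeroAngle ρ.im / 2) ≤ liZeroAngle ρ.im / 2 := Real.sin_le (by linarith)
  unfold amp
  refine ⟨by linarith, ?_⟩
  calc 4 * Real.sin (liZeroAngle ρ.im / 2) ≤ 4 * (liZeroAngle ρ.im / 2) := by linarith
    _ ≤ 2 * (1 / ρ.im) := by linarith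
    _ = 2 / ρ.im := by ring

/-- Auxiliary lemma `deriv_liZeroAngle` of the low-zero budget [γ] (pairs / NEAR part) (li-bridge g6 `SketchG6T`; see the module docstring for its place in the argument). -/
theorem deriv_liZeroAngle {t : ℝ} (ht : t ≠ 0) : deriv liZeroAngle t = -4 / (4 * t ^ 2 + 1) :=
  (hasDerivAt_liZeroAngle ht).deriv

/-- Mean-value lower bound: `θ(x) − θ(y) ≥ (y − x)/(2y²)` for `1 ≤ x < y`. -/
theorem phase_sub_ge {x y : ℝ} (hx : 1 ≤ x) (hxy : x < y) :
    (y - x) / (2 * y ^ 2) ≤ liZeroAngle x - liZeroAngle y := by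
  have hcont : ContinuousOn liZeroAngle (Set.Icc x y) := fun t ht ↦
    (hasDerivAt_liZeroAngle (by linarith [ht.1] : t ≠ 0)).continuousAt.continuousWithinAt
  have hdiff : DifferentiableOn ℝ liZeroAngle (interior (Set.Icc x y)) := fun t ht ↦ by
    rw [interior_Icc] at ht
    exact (hasDerivAt_liZeroAngle (by linarith [ht.1] : t ≠ 0)).differentiableAt.differentiableWithinAt
  have hle : ∀ t ∈ interior (Set.Icc x y), deriv liZeroAngle t ≤ -(1 / (2 * y ^ 2)) := by
    intro t ht
    rw [interior_Icc] at ht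
    rw [deriv_liZeroAngle (by linarith [ht.1] : t ≠ 0)]
    have hy : 0 < y := by linarith
    have ht2 : t ^ 2 ≤ y ^ 2 := by nlinarith [ht.1, ht.2]
    rw [neg_div, neg_le_neg_iff, div_le_div_iff₀ (by positivity) (by positivity)]
    nlinarith
  have h := (convex_Icc x y).image_sub_le_mul_sub_of_deriv_le hcont hdiff hle x
    (Set.left_mem_Icc.2 hxy.le) y (Set.right_mem_Icc.2 hxy.le) hxy.le
  have e : (y - x) / (2 * y ^ 2) = (1 / (2 * y ^ 2)) * (y - x) := by ring
  linarith

/-- `|θ_γ − θ_γ'| ≥ |γ − γ'| / (2 max(γ,γ')²)` for `γ, γ' ≥ 1`, `γ ≠ γ'`. -/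
theorem abs_phase_sub_ge {γ γ' : ℝ} (hγ : 1 ≤ γ) (hγ' : 1 ≤ γ') (hne : γ ≠ γ') :
    |γ - γ'| / (2 * max γ γ' ^ 2) ≤ |liZeroAngle γ - liZeroAngle γ'| := by
  rcases lt_or_gt_of_ne hne with h | h
  · calc |γ - γ'| / (2 * max γ γ' ^ 2) = (γ' - γ) / (2 * γ' ^ 2) := by
          rw [max_eq_right h.le, abs_sub_comm, abs_of_pos (sub_pos.2 h)]
      _ ≤ liZeroAngle γ - liZeroAngle γ' := phase_sub_ge hγ h
      _ ≤ |liZeroAngle γ - liZeroAngle γ'| := le_abs_self _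
  · calc |γ - γ'| / (2 * max γ γ' ^ 2) = (γ - γ') / (2 * γ ^ 2) := by
          rw [max_eq_left h.le, abs_of_pos (sub_pos.2 h)]
      _ ≤ liZeroAngle γ' - liZeroAngle γ := phase_sub_ge hγ' h
      _ ≤ |liZeroAngle γ - liZeroAngle γ'| := by rw [abs_sub_comm]; exact le_abs_self _

/-! ## §6 The budget and the per-pair bounds -/

/-- One term of the bilinear budget: `m m' · a a' · D_N(θ − θ')`. -/
def term (N : ℕ) (ρ ρ' : ℂ) : ℝ :=
  mult ρ * mult ρ' * (amp ρ * amp ρ') * dirichletBound N (phase ρ - phase ρ')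

/-- **The low-zero bilinear budget** `Σ_{0<γ,γ'≤Y} m m' a a' D_N(θ_γ − θ_γ')`. -/
def budget (N : ℕ) (Y : ℝ) : ℝ :=
  ∑ ρ ∈ zerosBetween 0 Y, ∑ ρ' ∈ zerosBetween 0 Y, term N ρ ρ'

/-- Auxiliary lemma `term_nonneg` of the low-zero budget [γ] (pairs / NEAR part) (li-bridge g6 `SketchG6T`; see the module docstring for its place in the argument). -/
theorem term_nonneg {N : ℕ} {ρ ρ' : ℂ} (hγ : 14 < ρ.im) (hγ' : 14 < ρ'.im) (hm : 0 ≤ mult ρ)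
    (hm' : 0 ≤ mult ρ') : 0 ≤ term N ρ ρ' := by
  unfold term
  have := (amp_bounds hγ).1
  have := (amp_bounds hγ').1
  have := dirichletBound_nonneg N (phase ρ - phase ρ')
  positivity

/-- NEAR pairs (`|γ − γ'| < 1`): `D_N ≤ N` and `a a' ≤ 4.4/γ²`. -/
theorem term_le_near {N : ℕ} (hN : 0 < N) {ρ ρ' : ℂ} (hγ : 14 < ρ.im) (hγ' : 14 < ρ'.im)
    (hm : 0 ≤ mult ρ) (hm' : 0 ≤ mult ρ') (hd : |ρ.im - ρ'.im| < 1) :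
    term N ρ ρ' ≤ 4.4 * N * (mult ρ * mult ρ') / ρ.im ^ 2 := by
  obtain ⟨ha0, ha1⟩ := amp_bounds hγ
  obtain ⟨ha0', ha1'⟩ := amp_bounds hγ'
  have hγ0 : 0 < ρ.im := by linarith
  have hγ0' : 0 < ρ'.im := by linarith
  have hlt : ρ.im - 1 < ρ'.im := by
    have := le_abs_self (ρ.im - ρ'.im); linarith
  have h2 : 2 / ρ'.im ≤ 2.2 / ρ.im := by
    rw [div_le_div_iff₀ hγ0' hγ0]; nlinarith
  have hA : amp ρ * amp ρ' ≤ 4.4 / ρ.im ^ 2 :=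
    calc amp ρ * amp ρ' ≤ (2 / ρ.im) * (2.2 / ρ.im) :=
          mul_le_mul ha1 (ha1'.trans h2) ha0' (by positivity)
      _ = 4.4 / ρ.im ^ 2 := by ring
  have hD := dirichletBound_le_card hN (phase ρ - phase ρ')
  have hD0 := dirichletBound_nonneg N (phase ρ - phase ρ')
  calc term N ρ ρ' = (mult ρ * mult ρ') * ((amp ρ * amp ρ') * dirichletBound N (phase ρ - phase ρ')) := by
        unfold term; ring
    _ ≤ (mult ρ * mult ρ') * ((4.4 / ρ.im ^ 2) * N) := by
        apply mul_le_mul_of_nonneg_left _ (mul_nonneg hm hm')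
        exact mul_le_mul hA hD hD0 (by positivity)
    _ = 4.4 * N * (mult ρ * mult ρ') / ρ.im ^ 2 := by ring

/-- FAR pairs (`|γ − γ'| ≥ 1`): `D_N ≤ π/|θ − θ'| ≤ 2π max²/|γ − γ'|`, whence
`term ≤ 8π m m' (1/|γ−γ'| + 1/γ + 1/γ')`. -/
theorem term_le_far {N : ℕ} {ρ ρ' : ℂ} (hγ : 14 < ρ.im) (hγ' : 14 < ρ'.im)
    (hm : 0 ≤ mult ρ) (hm' : 0 ≤ mult ρ') (hd : 1 ≤ |ρ.im - ρ'.im|) :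
    term N ρ ρ' ≤ 8 * Real.pi * (mult ρ * mult ρ') *
      (1 / |ρ.im - ρ'.im| + 1 / ρ.im + 1 / ρ'.im) := by
  set γ := ρ.im with hγdef
  set γ' := ρ'.im with hγ'def
  obtain ⟨ha0, ha1⟩ := amp_bounds hγ
  obtain ⟨ha0', ha1'⟩ := amp_bounds hγ'
  have hγ0 : 0 < γ := by linarith
  have hγ0' : 0 < γ' := by linarith
  have hne : γ ≠ γ' := by
    intro h; rw [h, sub_self, abs_zero] at hd; linarith
  have hdpos : 0 < |γ - γ'| := by linarith
  have hmax : 0 < max γ γ' := lt_max_of_lt_left hγ0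
  have hθ := abs_phase_sub_ge (by linarith : (1 : ℝ) ≤ γ) (by linarith : (1 : ℝ) ≤ γ') hne
  have hbpos : 0 < |γ - γ'| / (2 * max γ γ' ^ 2) := by positivity
  have hD : dirichletBound N (phase ρ - phase ρ') ≤ Real.pi / (|γ - γ'| / (2 * max γ γ' ^ 2)) :=
    dirichletBound_le_of_le_abs hbpos hθ
  have hD' : Real.pi / (|γ - γ'| / (2 * max γ γ' ^ 2)) = 2 * Real.pi * max γ γ' ^ 2 / |γ - γ'| := by
    field_simp
  rw [hD'] at hD
  have hA : amp ρ * amp ρ' ≤ (2 / γ) * (2 / γ') := mul_le_mul ha1 ha1' ha0' (by positivity)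
  have hD0 := dirichletBound_nonneg N (phase ρ - phase ρ')
  have hπ := Real.pi_pos
  -- the key algebraic inequality `max² /(γ γ' d) ≤ 1/d + 1/γ + 1/γ'`
  have hkey : (2 / γ) * (2 / γ') * (2 * Real.pi * max γ γ' ^ 2 / |γ - γ'|) ≤
      8 * Real.pi * (1 / |γ - γ'| + 1 / γ + 1 / γ') := by
    have e1 : (2 / γ) * (2 / γ') * (2 * Real.pi * max γ γ' ^ 2 / |γ - γ'|) =
        8 * Real.pi * (max γ γ' ^ 2 / (γ * γ' * |γ - γ'|)) := by
      field_simp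
      norm_num
    rw [e1]
    apply mul_le_mul_of_nonneg_left _ (by positivity)
    rw [div_le_iff₀ (by positivity)]
    have e2 : (1 / |γ - γ'| + 1 / γ + 1 / γ') * (γ * γ' * |γ - γ'|) =
        γ * γ' + γ' * |γ - γ'| + γ * |γ - γ'| := by
      field_simp
    rw [e2]
    rcases le_total γ γ' with h | h
    · rw [max_eq_right h, abs_of_nonpos (by linarith : γ - γ' ≤ 0)]
      nlinarith
    · rw [max_eq_left h, abs_of_nonneg (by linarith : 0 ≤ γ - γ')]
      nlinarith
  calc term N ρ ρ' = (mult ρ * mult ρ') * ((amp ρ * amp ρ') * dirichletBound N (phase ρ - phase ρ')) := by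
        unfold term; ring
    _ ≤ (mult ρ * mult ρ') * ((2 / γ) * (2 / γ') * (2 * Real.pi * max γ γ' ^ 2 / |γ - γ'|)) := by
        apply mul_le_mul_of_nonneg_left _ (mul_nonneg hm hm')
        exact mul_le_mul hA hD hD0 (by positivity)
    _ ≤ (mult ρ * mult ρ') * (8 * Real.pi * (1 / |γ - γ'| + 1 / γ + 1 / γ')) :=
        mul_le_mul_of_nonneg_left hkey (mul_nonneg hm hm')
    _ = 8 * Real.pi * (mult ρ * mult ρ') * (1 / |γ - γ'| + 1 / γ + 1 / γ') := by ring

/-! ## §7 The NEAR part: `Σ_ρ Σ_{|γ−γ'|<1} term ≤ 26.4 · P · N` -/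

/-- Inner near sum for a fixed zero `ρ`. -/
theorem inner_near_le {N : ℕ} (hN : 0 < N) {Y : ℝ} {ρ : ℂ} (hρ : ρ ∈ zerosBetween 0 Y) :
    ∑ ρ' ∈ (zerosBetween 0 Y).filter (fun ρ' ↦ |ρ.im - ρ'.im| < 1), term N ρ ρ'
      ≤ 26.4 * N * (mult ρ * Real.log (ρ.im + 2) / ρ.im ^ 2) := by
  have hγ := fourteen_lt_im hρ
  have hm := mult_nonneg le_rfl hρ
  have h1 : ∑ ρ' ∈ (zerosBetween 0 Y).filter (fun ρ' ↦ |ρ.im - ρ'.im| < 1), term N ρ ρ' ≤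
      ∑ ρ' ∈ (zerosBetween 0 Y).filter (fun ρ' ↦ |ρ.im - ρ'.im| < 1),
        4.4 * N * (mult ρ * mult ρ') / ρ.im ^ 2 := by
    apply Finset.sum_le_sum
    intro ρ' hρ'
    rw [Finset.mem_filter] at hρ'
    exact term_le_near hN hγ (fourteen_lt_im hρ'.1) hm (mult_nonneg le_rfl hρ'.1) hρ'.2
  have h2 : ∑ ρ' ∈ (zerosBetween 0 Y).filter (fun ρ' ↦ |ρ.im - ρ'.im| < 1),
        4.4 * N * (mult ρ * mult ρ') / ρ.im ^ 2 =
      (4.4 * N * mult ρ / ρ.im ^ 2) *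
        ∑ ρ' ∈ (zerosBetween 0 Y).filter (fun ρ' ↦ |ρ.im - ρ'.im| < 1), mult ρ' := by
    rw [Finset.mul_sum]
    apply Finset.sum_congr rfl
    intro ρ' _
    ring
  have h3 : ∑ ρ' ∈ (zerosBetween 0 Y).filter (fun ρ' ↦ |ρ.im - ρ'.im| < 1), mult ρ' ≤
      ∑ ρ' ∈ zerosBetween (ρ.im - 1) (ρ.im + 1), mult ρ' := by
    apply Finset.sum_le_sum_of_subset_of_nonneg
    · intro ρ' hρ'
      rw [Finset.mem_filter] at hρ'
      obtain ⟨hz, a, b, -, -⟩ := mem_zb le_rfl hρ'.1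
      have h' := hρ'.2
      rw [abs_lt] at h'
      exact (mem_zerosBetween (by linarith)).2 ⟨hz, a, b, by linarith, by linarith⟩
    · intro ρ' hρ' _
      exact mult_nonneg (by linarith) hρ'
  have h4 := sum_mult_two_windows_le (by linarith : (1 : ℝ) ≤ ρ.im)
  have hc : 0 ≤ 4.4 * N * mult ρ / ρ.im ^ 2 := by positivity
  calc _ ≤ _ := h1
    _ = _ := h2
    _ ≤ (4.4 * N * mult ρ / ρ.im ^ 2) * (6 * Real.log (ρ.im + 2)) :=
        mul_le_mul_of_nonneg_left (h3.trans h4) hc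
    _ = 26.4 * N * (mult ρ * Real.log (ρ.im + 2) / ρ.im ^ 2) := by ring

/-- The near weight sum converges: `Σ_{0<γ≤Y} m log(γ+2)/γ² ≤ P` uniformly in `Y`. -/
theorem near_weight_sum_le (Y : ℝ) :
    ∑ ρ ∈ zerosBetween 0 Y, mult ρ * Real.log (ρ.im + 2) / ρ.im ^ 2 ≤ nearConst := by
  have h1 : ∑ ρ ∈ zerosBetween 0 Y, mult ρ * Real.log (ρ.im + 2) / ρ.im ^ 2 ≤
      ∑ k ∈ range ⌈Y⌉₊, ∑ ρ ∈ zerosBetween (k : ℝ) (k + 1),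
        mult ρ * Real.log (ρ.im + 2) / ρ.im ^ 2 := by
    apply sum_le_windows (F := fun ρ ↦ mult ρ * Real.log (ρ.im + 2) / ρ.im ^ 2)
    intro b ρ h
    have h14 := fourteen_lt_im h
    have hm := mult_nonneg le_rfl h
    have hl : 0 ≤ Real.log (ρ.im + 2) := Real.log_nonneg (by linarith)
    positivity
  have h2 : ∀ k ∈ range ⌈Y⌉₊, ∑ ρ ∈ zerosBetween (k : ℝ) (k + 1),
      mult ρ * Real.log (ρ.im + 2) / ρ.im ^ 2 ≤ 96 * (1 / (k : ℝ) ^ (3 / 2 : ℝ)) := by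
    intro k _
    have hl3 : 0 ≤ Real.log ((k : ℝ) + 3) := Real.log_nonneg (by linarith [(Nat.cast_nonneg k : (0 : ℝ) ≤ k)])
    have hl2 : 0 ≤ Real.log ((k : ℝ) + 2) := Real.log_nonneg (by linarith [(Nat.cast_nonneg k : (0 : ℝ) ≤ k)])
    have hl23 : Real.log ((k : ℝ) + 2) ≤ Real.log ((k : ℝ) + 3) :=
      Real.log_le_log (by linarith [(Nat.cast_nonneg k : (0 : ℝ) ≤ k)]) (by linarith)
    have hterm : ∀ ρ ∈ zerosBetween (k : ℝ) (k + 1), mult ρ * Real.log (ρ.im + 2) / ρ.im ^ 2 ≤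
        mult ρ * (Real.log ((k : ℝ) + 3) / (k : ℝ) ^ 2) := by
      intro ρ hρ
      obtain ⟨hk1, hk2, h14, hk13, hm⟩ := mem_window hρ
      have hlog : Real.log (ρ.im + 2) ≤ Real.log ((k : ℝ) + 3) :=
        Real.log_le_log (by linarith) (by linarith)
      have hlog0 : 0 ≤ Real.log (ρ.im + 2) := Real.log_nonneg (by linarith)
      have hsq : (k : ℝ) ^ 2 ≤ ρ.im ^ 2 := by nlinarith
      have hk0 : (0 : ℝ) < (k : ℝ) ^ 2 := by positivity
      rw [mul_div_assoc]
      apply mul_le_mul_of_nonneg_left _ hm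
      calc Real.log (ρ.im + 2) / ρ.im ^ 2 ≤ Real.log (ρ.im + 2) / (k : ℝ) ^ 2 :=
            div_le_div_of_nonneg_left hlog0 hk0 hsq
        _ ≤ Real.log ((k : ℝ) + 3) / (k : ℝ) ^ 2 := div_le_div_of_nonneg_right hlog (by positivity)
    calc ∑ ρ ∈ zerosBetween (k : ℝ) (k + 1), mult ρ * Real.log (ρ.im + 2) / ρ.im ^ 2
        ≤ ∑ ρ ∈ zerosBetween (k : ℝ) (k + 1), mult ρ * (Real.log ((k : ℝ) + 3) / (k : ℝ) ^ 2) :=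
          Finset.sum_le_sum hterm
      _ = (∑ ρ ∈ zerosBetween (k : ℝ) (k + 1), mult ρ) * (Real.log ((k : ℝ) + 3) / (k : ℝ) ^ 2) := by
          rw [Finset.sum_mul]
      _ ≤ (3 * Real.log ((k : ℝ) + 2)) * (Real.log ((k : ℝ) + 3) / (k : ℝ) ^ 2) :=
          mul_le_mul_of_nonneg_right (sum_mult_window_nat k) (div_nonneg hl3 (sq_nonneg _))
      _ ≤ (3 * Real.log ((k : ℝ) + 3)) * (Real.log ((k : ℝ) + 3) / (k : ℝ) ^ 2) :=
          mul_le_mul_of_nonneg_right (by linarith) (div_nonneg hl3 (sq_nonneg _))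
      _ = 3 * Real.log ((k : ℝ) + 3) ^ 2 / (k : ℝ) ^ 2 := by ring
      _ ≤ 96 * (1 / (k : ℝ) ^ (3 / 2 : ℝ)) := near_majorant k
  calc _ ≤ _ := h1
    _ ≤ ∑ k ∈ range ⌈Y⌉₊, 96 * (1 / (k : ℝ) ^ (3 / 2 : ℝ)) := Finset.sum_le_sum h2
    _ ≤ nearConst := sum_majorant_le _

/-- NEAR TOTAL. -/
theorem near_total_le {N : ℕ} (hN : 0 < N) (Y : ℝ) :
    ∑ ρ ∈ zerosBetween 0 Y, ∑ ρ' ∈ (zerosBetween 0 Y).filter (fun ρ' ↦ |ρ.im - ρ'.im| < 1),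
      term N ρ ρ' ≤ 26.4 * nearConst * N := by
  calc _ ≤ ∑ ρ ∈ zerosBetween 0 Y, 26.4 * N * (mult ρ * Real.log (ρ.im + 2) / ρ.im ^ 2) :=
        Finset.sum_le_sum fun ρ hρ ↦ inner_near_le hN hρ
    _ = 26.4 * N * ∑ ρ ∈ zerosBetween 0 Y, mult ρ * Real.log (ρ.im + 2) / ρ.im ^ 2 := by
        rw [Finset.mul_sum]
    _ ≤ 26.4 * N * nearConst := mul_le_mul_of_nonneg_left (near_weight_sum_le Y) (by positivity)
    _ = 26.4 * nearConst * N := by ring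

end Summit.RiemannHypothesis.RiemannHypothesis.Theorems.Splittings.LiLowZeroBudget

end
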